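import Summits.ResolutionOfSingularities.ResolutionOfSingularities.Theorems.FrobeniusClosingPatchingRelPerfectDepthPhaseCLocalGamePatchReduction
import Literature.AlgebraicGeometry.Resolution.StrictNormalCrossingsFibre
import Literature.AlgebraicGeometry.Resolution.StalkIdealGenerization
import Literature.AlgebraicGeometry.Resolution.SncStrata
import HarnessLib

/-!
# Crux `PatchingRelPerfect` (stmt-ResolutionOfSingularities-16161), chain W5.2 — F7(β) (β-AX) X3 C-I (G2) engine:
# A BAD PIECE IS NOWHERE LEGAL (brick (b3a) `PieceBadness`)

[OURS · L1 W5.2 · res-D-pv-046 ENGINE NOTE 4 2026-08-27T21:48:11Z CLAIM 1 («KEY LEMMA (no splitting)», the hypothesis on the bad pieces),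
res-L1-w52-lead-1 RECORD R13-4 (1); line `Cruxes/PatchingRelPerfect/Lines/closed_point_slice.lean`.]  Replaces the role of NO printed item;
NOT a statement of the manuscript under review; fact-free; def-free; any locally Noetherian scheme.  AI-written; AI review is weaker than
expert review.

THE STATEMENT (`not_subset_support_marked_of_weight_lt`).  On a piece carrying the Route-K dictionary `MonomialCleanup.GameInv s Es 𝒦 lab`
(snc pointed-distinct letters `Es`, rows `𝒦`), let `J ⊆ s.B` and suppose SOME game vector `α₀` has weight `< m` on `J` («`J` is not legal
for the marking `m`»).  Then NO non-empty relatively open part `V(J) ∩ W` of the `J`-stratum lies in the marked support `Sing(Σ𝒦, m)` — the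
hypothesis under which brick (b1) `ClopenCentre.exists_clopenCentre(_of_pieces)` makes the maximal legal extension of the active centre MISS
this piece.

THE PROOF (no dimension theory): at a point `y ∈ V(J) ∩ W` the stalk ideal `q := 𝓘(V(J))_y` is the prime generated by the parameters of the
letters of `J` (snc); the GENERISATION `ξ := η_q ∈ Spec 𝒪_y → Y` of `y` lies in `W`, on every letter of `J`, and on NO OTHER letter — a letter
`F ∉ J` through `y` containing `ξ` would have its parameter in `q`, but it is a non-zero-divisor modulo `q` (Literature
`HasSNC.nonZeroDivisor_data`), and a letter not through `y` misses the generisation `ξ`.  So the clique of `ξ` labels into `J`, the order of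
`Σ𝒦` at `ξ` is at most the weight of `α₀` on `J`, `< m`: `ξ ∉ Sing(Σ𝒦, m)` although `ξ ∈ V(J) ∩ W`.
(Literature `mem_support_iff_stalkIdeal_le_primeOfSpecializes`, `fromSpecStalk_specializes`, `primeOfSpecializes_fromSpecStalk`, Stacks 01J7.)

## References (for the mathematics; nothing here is a statement of the manuscript under review)
* E. Bierstone, P. Milman, *Desingularization of toric and binomial varieties*, J. Algebraic Geom. 15 (2006), proof of Thm. 8.5 («Of course,
  supp 𝓗 ∩ U_σ = ∅ unless 𝓗_σ is generated by monomials of degree ≥ e»). [BierstoneMilman2006]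
* The Stacks Project, Tag 01J7 (points of `Spec 𝒪_{X,x}` = generisations of `x`). [StacksProject]
* E. Bierstone, D. Grigoriev, P. Milman, J. Włodarczyk, arXiv:1206.3090, Def. 3.1.1 (snc). [BierstoneGrigorievMilmanWlodarczyk2011]
-/

-- `Summit.<Summit>.<Sub>.Theorems` with `Sub = Summit` (single-conjunct summit, D-0017)
set_option linter.dupNamespace false

noncomputable section

open CategoryTheory AlgebraicGeometry TopologicalSpace IsLocalRing
open Literature.AlgebraicGeometry.Resolution

namespace Summit.ResolutionOfSingularities.ResolutionOfSingularities.Theorems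

namespace MonomialCleanup

open DepthTargets (monomialSum monomialSum_nil monomialSum_cons)
open PolyhedraGame (State move weight weight_mono)

universe u

variable {Y : Scheme.{u}}

open Classical in
/-- **A BAD PIECE IS NOWHERE LEGAL.**  With the dictionary `GameInv s Es 𝒦 lab` on `Y`, `J ⊆ s.B`, and a game vector `α₀ ∈ s.A` of weight `< m`
on `J`: no non-empty relatively open part `V(J) ∩ W` of the `J`-stratum `V(J) = Supp ⨆{Es[k] : lab k ∈ J}` lies in the marked support
`Sing(Σ𝒦, m)` (the generisation of any of its points along the stratum has clique exactly inside `J`, hence order `< m`).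
[cite: BierstoneMilman2006, proof of Thm. 8.5] [cite: StacksProject, Tag 01J7] -/
theorem not_subset_support_marked_of_weight_lt [IsLocallyNoetherian Y] {m : ℕ} {s : State} {Es : List Y.IdealSheafData}
    {𝒦 : List (List (Y.IdealSheafData × ℕ))} {lab : ℕ → ℕ} (hinv : GameInv s Es 𝒦 lab)
    {J : Finset ℕ} {α₀ : ℕ →₀ ℕ} (hα₀ : α₀ ∈ s.A) (hwt : weight J α₀ < m) (W : Y.Opens)
    (hne : (((((posOf Es lab J).image (nthSheaf Es)).sup id).support : Set Y) ∩ W).Nonempty) :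
    ¬ ((((((posOf Es lab J).image (nthSheaf Es)).sup id).support : Set Y) ∩ W) ⊆
        (⟨monomialSum 𝒦, [], m⟩ : MarkedIdeal Y).support) := by
  intro hsub
  obtain ⟨y, hyC, hyW⟩ := hne
  set P := posOf Es lab J with hPdef
  set T := P.image (nthSheaf Es) with hTdef
  have hPlt : ∀ k ∈ P, k < Es.length := fun k hk => (mem_posOf_iff.mp hk).1
  have hT : ∀ K ∈ T, K ∈ Es := image_nthSheaf_subset hPlt
  have hyT : ∀ K ∈ T, y ∈ K.support := (mem_support_finsetSup_iff T y).mp hyC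
  -- generators of the stalk ideals of the letters
  have hgen : ∀ (x : Y) (D : Y.IdealSheafData), ∃ g : Y.presheaf.stalk x,
      D ∈ Es → x ∈ D.support → stalkIdeal D x = Ideal.span {g} := by
    intro x D
    by_cases h : D ∈ Es ∧ x ∈ D.support
    · obtain ⟨-, u, -, ⟨ι, -, hιu⟩, -⟩ := hinv.snc x
      exact ⟨u (ι ⟨D, h.1, h.2⟩), fun _ _ => hιu ⟨D, h.1, h.2⟩⟩
    · exact ⟨0, fun hD hx => absurd ⟨hD, hx⟩ h⟩
  choose f hf using hgen
  have hf' : ∀ x : Y, ∀ D ∈ Es, x ∈ D.support → stalkIdeal D x = Ideal.span {f x D} := fun x D hD hx => hf x D hD hx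
  have hTy : ∀ D ∈ T, D ∈ Es ∧ y ∈ D.support := fun D hD => ⟨hT D hD, hyT D hD⟩
  obtain ⟨hregq, hnzd⟩ := hinv.snc.nonZeroDivisor_data f hf' y T hTy
  set qI : Ideal (Y.presheaf.stalk y) := Ideal.span (f y '' (T : Set Y.IdealSheafData)) with hqI
  -- the stalk ideal of the stratum is `qI`
  have hCq : stalkIdeal (T.sup id) y = qI := by
    rw [stalkIdeal_finsetSup, hqI, ← Finset.sup_span_singleton_eq_span_image]
    exact Finset.sup_congr rfl fun K hK => hf' y K (hT K hK) (hyT K hK)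
  haveI : IsRegularLocalRing (Y.presheaf.stalk y ⧸ qI) := hregq
  haveI : IsDomain (Y.presheaf.stalk y ⧸ qI) := isDomain_of_isRegularLocalRing _
  have hqprime : qI.IsPrime := (Ideal.Quotient.isDomain_iff_prime qI).mp inferInstance
  -- the generisation of `y` along the stratum
  let q : PrimeSpectrum (Y.presheaf.stalk y) := ⟨qI, hqprime⟩
  set ξ : Y := Y.fromSpecStalk y q with hξdef
  have hξy : ξ ⤳ y := fromSpecStalk_specializes q
  have hmem : ∀ I : Y.IdealSheafData, ξ ∈ I.support ↔ stalkIdeal I y ≤ qI := fun I => by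
    rw [hξdef, mem_support_iff_stalkIdeal_le_primeOfSpecializes (fromSpecStalk_specializes q) I,
      primeOfSpecializes_fromSpecStalk]
  -- `ξ` lies on the stratum and in `W`, hence in the marked support
  have hξC : ξ ∈ (((T.sup id).support : Set Y)) := (hmem _).mpr hCq.le
  have hξW : ξ ∈ (W : Set Y) := hξy.mem_open W.isOpen hyW
  have hξS := hsub ⟨hξC, hξW⟩
  have h𝒦 : ∀ A ∈ 𝒦, HasSNC (boundaryOf A) := fun A hA => by rw [hinv.bd A hA]; exact hinv.snc
  have hwtξ := (PolyhedraGame.RouteK.mem_support_monomialSum_marked_iff 𝒦 h𝒦 [] m ξ).mp hξS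
  -- the row of `α₀` and the clique of `ξ`
  obtain ⟨B₀, hB₀, hagr⟩ := hinv.bwd α₀ hα₀
  set S : Finset ℕ := (Finset.range Es.length).filter fun k => ξ ∈ (nthSheaf Es k).support with hSdef
  have hS : ∀ k, k ∈ S ↔ k < Es.length ∧ ξ ∈ (nthSheaf Es k).support := fun k => by
    rw [hSdef, Finset.mem_filter, Finset.mem_range]
  have hwS : weight (S.image lab) α₀ = weightAt B₀ ξ := hinv.weight_image_lab_eq_weightAt hB₀ hagr hS
  -- the clique of `ξ` labels into `J`
  have hSJ : S.image lab ⊆ J := by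
    intro j hj
    obtain ⟨k, hk, rfl⟩ := Finset.mem_image.mp hj
    obtain ⟨hklt, hξk⟩ := (hS k).mp hk
    by_contra hkJ
    set F := nthSheaf Es k with hF
    have hFEs : F ∈ Es := nthSheaf_mem hklt
    have hyF : y ∈ F.support := hξy.mem_closed F.support.isClosed hξk
    -- `F` is not a letter of the stratum (pointed-distinctness at `y`)
    have hFT : F ∉ T := by
      intro hFT'
      obtain ⟨k', hk'P, hk'F⟩ := Finset.mem_image.mp hFT'
      have hk'lt : k' < Es.length := hPlt k' hk'P
      by_cases hkk' : k = k'
      · subst hkk'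
        exact hkJ (mem_posOf_iff.mp hk'P).2
      · have hyF' : y ∈ (nthSheaf Es k').support := by rw [hk'F]; exact hyF
        exact hinv.pd k k' hklt hk'lt hkk' y hyF hyF' (by rw [← hF, hk'F])
    -- its parameter is a non-zero-divisor modulo `qI`, yet it lies in `qI`
    have hle : stalkIdeal F y ≤ qI := (hmem F).mp hξk
    rw [hf' y F hFEs hyF, Ideal.span_singleton_le_iff_mem] at hle
    have hz : Ideal.Quotient.mk qI (f y F) = 0 := Ideal.Quotient.eq_zero_iff_mem.mpr hle
    have hnz := hnzd F hFEs hyF hFT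
    rw [hz] at hnz
    exact zero_notMem_nonZeroDivisors hnz
  -- the order at `ξ` is `< m`
  have h1 : m ≤ weightAt B₀ ξ := hwtξ B₀ hB₀
  have h2 : weightAt B₀ ξ ≤ weight J α₀ := by
    rw [← hwS]
    exact weight_mono hSJ α₀
  omega

end MonomialCleanup

end Summit.ResolutionOfSingularities.ResolutionOfSingularities.Theorems

end
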